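import Literature.NumberTheory.Automorphic.PairLFunctionPolesEqConjArch
import Literature.NumberTheory.Automorphic.PairLFunctionPolesEqConjLeTwo
import Literature.NumberTheory.Automorphic.ArchRankinSelbergAbsConvergence
import HarnessLib

/-!
# Arthur–Clozel (2.3) in every rank from the named archimedean fact of Jacquet–Shalika

Topic `NumberTheory/Automorphic`; namespace `Literature.NumberTheory.Automorphic`. Theorems only (no
definition, no named fact). The named fact `JacquetShalika1981_partialPairL_pole_of_eq_conj`
(`PairLFunctionPoles`; Arthur–Clozel (1989), Ch. 3 §2 (2.3), p. 171: for unitary cuspidal `π` on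
`GL_n(𝔸_K)` and `σ ≅ π̃`, `lim_{s → 1, Re s > 1} (s - 1) L^S(s, π ⊗ σ)` exists, is finite and non-zero)
is reduced in the tree, in every rank, to Jacquet–Shalika's ARCHIMEDEAN convergence theorem, spelled
out as the hypothesis `hX` of
`JacquetShalika1981_partialPairL_pole_of_eq_conj_of_archRankinSelbergConvergence'`
(`PairLFunctionPolesEqConjArch`: global Rankin–Selberg method, residue of the mirabolic Eisenstein
series, thin test functions and spread test vectors at the finite places, archimedean bridge). That
hypothesis is now a named fact of the tree,
`JacquetShalika1990_archRankinSelbergLIntegral_lt_top n K` (`ArchRankinSelbergAbsConvergence`;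
Jacquet–Shalika (1990) = Cogdell (2004), §3.1 item (1) with §3.2; Jacquet (2009), Thm. 2.1), whose
body is `hX` verbatim. This file records the resulting one-step implications between NAMED facts:

* `JacquetShalika1981_partialPairL_pole_of_eq_conj_of_archRankinSelbergLIntegral_lt_top` — in rank
  `n`, the archimedean fact in rank `n` implies (2.3) in rank `n`;
* `JacquetShalika1981_partialPairL_pole_of_eq_conj_of_archRankinSelbergLIntegral_lt_top_of_two_lt` —
  since ranks `n ≤ 2` are unconditional in the tree
  (`JacquetShalika1981_partialPairL_pole_of_eq_conj_holds_of_le_two`: Dedekind zeta for `n = 1`, the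
  Kirillov `L²`-bound for `n = 2`), only the archimedean fact in ranks `n ≥ 3` is used;
* `JacquetShalika1981_partialPairL_pole_of_eq_conj_forall_rank_of_archRankinSelbergLIntegral_lt_top` —
  the all-ranks packaging `∀ a, (2.3) in rank a` consumed by the cuspidal-descent files
  (`ArthurClozelCuspidalDescentCharacterIdentity`, hypothesis `h23F`), from the archimedean fact in
  ranks `≥ 3`.

Consequently the discharge `JacquetShalika1981_partialPairL_pole_of_eq_conj_holds` is, verbatim,
`JacquetShalika1981_partialPairL_pole_of_eq_conj_of_archRankinSelbergLIntegral_lt_top (X_holds n K)`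
as soon as a proof `X_holds` of `JacquetShalika1990_archRankinSelbergLIntegral_lt_top` is in the tree
(none yet: for `n ≥ 3` it is the asymptotics / majorisation of archimedean Whittaker functions of
unitary generic representations, Jacquet–Shalika (1990), Jacquet (2009)).

## References

* J. Arthur, L. Clozel, *Simple algebras, base change, and the advanced theory of the trace formula*,
  Ann. of Math. Stud. 120 (1989), Ch. 3 §2, (2.3), p. 171 [ArthurClozelAMS120].
* H. Jacquet, J. A. Shalika, *On Euler products and the classification of automorphic
  representations I*, Amer. J. Math. 103 (1981), 499–558, §4–§5, Thm. (5.3) [JacquetShalikaAJM1981].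
* H. Jacquet, J. A. Shalika, *Rankin–Selberg convolutions: Archimedean theory*, Israel Math. Conf.
  Proc. 2 (1990), 125–207 [JacquetShalikaArchimedean1990].
* H. Jacquet, *Archimedean Rankin–Selberg integrals*, Contemp. Math. 489 (2009), Thm. 2.1
  [JacquetArchimedeanRS2009].
* J. W. Cogdell, *Analytic theory of L-functions for GL_n* (2004), §3.1 (1), §3.2, §4.2
  [CogdellAnalyticTheory2004].
-/

noncomputable section

open MeasureTheory

namespace Literature.NumberTheory.Automorphic

variable {n : ℕ} {K : Type} [Field K] [NumberField K]
variable {μ : Measure (AdelicGroupData.gl n K).automorphicQuotient}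
  [(AdelicGroupData.gl n K).IsAutomorphicMeasure μ]

/-- **Arthur–Clozel (2.3) in rank `n` from Jacquet–Shalika's archimedean convergence theorem in rank
`n`** (named fact `JacquetShalika1990_archRankinSelbergLIntegral_lt_top n K` ⟹ named fact
`JacquetShalika1981_partialPairL_pole_of_eq_conj` in rank `n`): the body of the archimedean fact is
verbatim the hypothesis `hX` of the landed reduction
`JacquetShalika1981_partialPairL_pole_of_eq_conj_of_archRankinSelbergConvergence'`.
[cite: ArthurClozelAMS120, Ch. 3 §2, (2.3), p. 171] [cite: JacquetShalikaAJM1981, §4 and Thm. (5.3)]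
[cite: CogdellAnalyticTheory2004, §3.1 item (1), §3.2 and §4.2] -/
theorem JacquetShalika1981_partialPairL_pole_of_eq_conj_of_archRankinSelbergLIntegral_lt_top
    (hX : JacquetShalika1990_archRankinSelbergLIntegral_lt_top n K) :
    JacquetShalika1981_partialPairL_pole_of_eq_conj (n := n) (K := K) (μ := μ) :=
  JacquetShalika1981_partialPairL_pole_of_eq_conj_of_archRankinSelbergConvergence' hX

/-- **Arthur–Clozel (2.3) in rank `n`, using the archimedean theorem only in ranks `n ≥ 3`**: ranks
`n ≤ 2` are unconditional in the tree (`JacquetShalika1981_partialPairL_pole_of_eq_conj_holds_of_le_two`).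
[cite: ArthurClozelAMS120, Ch. 3 §2, (2.3), p. 171] -/
theorem JacquetShalika1981_partialPairL_pole_of_eq_conj_of_archRankinSelbergLIntegral_lt_top_of_two_lt
    (hX : 2 < n → JacquetShalika1990_archRankinSelbergLIntegral_lt_top n K) :
    JacquetShalika1981_partialPairL_pole_of_eq_conj (n := n) (K := K) (μ := μ) := by
  rcases Nat.lt_or_ge 2 n with h3 | h2
  · exact JacquetShalika1981_partialPairL_pole_of_eq_conj_of_archRankinSelbergLIntegral_lt_top (hX h3)
  · exact JacquetShalika1981_partialPairL_pole_of_eq_conj_holds_of_le_two h2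

omit [(AdelicGroupData.gl n K).IsAutomorphicMeasure μ] in
/-- **Arthur–Clozel (2.3) in all ranks at once** (the packaging `∀ a, …` consumed as `h23F` by the
cuspidal-descent files), from Jacquet–Shalika's archimedean convergence theorem in ranks `≥ 3`.
[cite: ArthurClozelAMS120, Ch. 3 §2, (2.3), p. 171] -/
theorem JacquetShalika1981_partialPairL_pole_of_eq_conj_forall_rank_of_archRankinSelbergLIntegral_lt_top
    (hX : ∀ a : ℕ, 2 < a → JacquetShalika1990_archRankinSelbergLIntegral_lt_top a K)
    (μF : (a : ℕ) → Measure (AdelicGroupData.gl a K).automorphicQuotient)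
    [hμF : ∀ a, (AdelicGroupData.gl a K).IsAutomorphicMeasure (μF a)] (a : ℕ) :
    JacquetShalika1981_partialPairL_pole_of_eq_conj (n := a) (K := K) (μ := μF a) :=
  JacquetShalika1981_partialPairL_pole_of_eq_conj_of_archRankinSelbergLIntegral_lt_top_of_two_lt (hX a)

end Literature.NumberTheory.Automorphic
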